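import Summits.QuantumFields.YangMills.Theorems.BalabanUVNodesK0Stub1ColumnTerritory
import Summits.QuantumFields.YangMills.Theorems.BalabanUVNodesK0Stub1CorrectedCurrentLetter

/-!
# K0⁷ STUB 1 (`stub_prop8StepCoP13`), sub-target S4a — **THE WEIGHTED k-UNIFORM SUP LETTER OF THE CORRECTED CURRENT** (the (98)-slot currency of the heart:
# `w_m(b′)·‖(RᵀW)(b′)‖ ≤ 12·d·(d+2)·L·L^m · sup_b w_m(b)·‖W(b)‖` for the LEVEL WEIGHTS `w_m(b) = (L^{j(b₋)}·L^{−k′})^m` of [15] (98)∕(152), `j(x)` the territory of `x`)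

Cell `pub-ymgap`, width seat `pub-ymgap-k0-s1-w1` g6 (CLAIM-2, file 2∕2; ASKED by k0-s1-w2 g4 ■: «the W-slot `hWq` of p612123∕p621022 is in the `w 3`-WEIGHTED sup currency … the S4b
bookkeeping absorbs your constant only through a WEIGHTED edition `w₃(b′)‖RᵀW b′‖ ≤ C′·sup_b w₃(b)‖W b‖ — true by your locality … `C′ ≤ 12d(d+2)L·L³`; one more conjunct on your
side»).  `--kind proof --supports stmt-QuantumFields-20541 --as helper`; count-neutral.  Built on `…K0Stub1ColumnTerritory` (file 1∕2), `…K0Stub1CombColumnLetter` (p624703) and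
`…K0Stub1CorrectedCurrentLetter` (p625278).  [15] = [Balaban1985Variational]; [B6] = [Balaban1984PropagatorsII]; [B7] = [Balaban1985Averaging].

WHY.  The bonds `b` entering `(RᵀW)(b′)` have an end-point at a centre reading `b′`; by file 1∕2 such a centre has the territory of `b′₋` and its lattice neighbours have territory
at least `j(b′₋) − 1`, so `w_m(b′) ≤ L^m·w_m(b)` along the column: the weighted letter holds with the extra factor `L^m` (for `m = 3`: `C′ = 12·d·(d+2)·L⁴`).

WHAT IS PROVED (sorry-free; no definition; axioms standard; `M = M_N(ℂ)`, operator norm).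
* §1 ★★ `weighted_norm_transpose_apply_le` — ABSTRACT: columns `c(x)•Z(b′)` of mass `≤ K` whose support only meets bonds `b` with `ω(b′) ≤ Θ·ω(b)`, skew `Rᵀ` with the transpose
  identity ⇒ `ω(b′)·‖(RᵀV)(b′)‖ ≤ 2·d·K·Θ·s` whenever `ω(b)·‖V(b)‖ ≤ s` (`ω(b′) > 0`).
* §2 ★★★ `exists_correctedCurrent_letters_lieSU` — p625278's `exists_correctedCurrent_letter_lieSU` (p618723's 𝔰𝔲(N) junction + the unweighted letter) PLUS the WEIGHTED letter:
  `∀ m k′ V s, 0 ≤ s → (∀ b, (L^{levOf b₋}·(L⁻¹)^{k′})^m·‖V b‖ ≤ s) → ∀ b, (L^{levOf b₋}·(L⁻¹)^{k′})^m·‖Rt V b‖ ≤ 12·d·((d+2)L)·L^m·s`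
  (`levOf` over the family's regions `{x | D.InOm i x}` at `D.k` — the `IsLevWeight` shape of UST∕k0-s1-w3's texts; hypothesis `2 ≤ P.d`).

HONEST SCOPE.  Lattice bookkeeping + finite-dimensional duality over kernel-checked identities; NO estimate of Bałaban's asserted; the SOCKET `h127rec` is NOT produced here (S2∕S4b);
on the ♭ road (R1′) the corrected current is moot (`T = 0`); `stub_prop8StepCoP13` ∕ K0⁷ NOT closed; N07 NOT discharged; counts unmoved (28∕28 · 5∕27); one finite 𝕋⁴ programme at
fixed ε — R4 closes the conditional finite-𝕋⁴ rung `BalabanLadder.UV` only, never the summit; the YM mass gap (Clay) is NOT proved by any of this; nothing continuum ∕ ℝ⁴ ∕ OS.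
No `sorry`, no `def`, no `instance`, no `notation`.

References: [15] (98) p.292, (127)–(128) p.297, (152) p.301, (165) p.303; [B6] (2.1)–(2.4) p.224, (2.19)–(2.20) p.226; [B7] (62) p.28.
-/

set_option autoImplicit false
noncomputable section
open scoped BigOperators Matrix Matrix.Norms.L2Operator

namespace Summit.QuantumFields.YangMills.Theorems.K0Stub1CorrectedCurrentWeightedLetter

open Literature.MathematicalPhysics.QuantumFieldTheory.Balaban1983to89
open LatticeFieldCalculus (bondAvgIter)
open B11Eq115Space (levOf)
open T4AdjointCovarianceUnitary (lieSU mem_lieSU_iff)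
open B6SectADomainsV1 (Domains)
open B6SectAOperatorsV1 (BondIdx QE)
open Node00 (dIterL)
open WithLp (toLp ofLp)
open Summit.QuantumFields.YangMills.Theorems.K0Stub1CorrectedCurrentJunction (exists_transpose_pairing pairing_add_left pairing_add_right pairing_sub_right
  pairing_smul_right pairing_conjTranspose_right_of_skew)
open Summit.QuantumFields.YangMills.Theorems.K0Stub1FlatAveragingDictionaryLevels (exists_linear_gauge_dIterL_one_eq_zero_of_bondAvgIter_eq_zero lamSite_or_of_lamBond)
open Summit.QuantumFields.YangMills.Theorems.K0Stub1CorrectedCurrentLetter (conjTranspose_rankTwoSkew abs_re_trace_rankTwoSkew_le l2_opNorm_le_of_rankTwoSkew_tests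
  sum_bond_ends_eq norm_transpose_apply_le)
open Summit.QuantumFields.YangMills.Theorems.K0Stub1ColumnTerritory (exists_column_support_of_dichotomy levOf_le_succ_of_adjacent)

variable {P : Params} {N : ℕ}

/-! ## §1  The weighted abstract letter -/

section Abstract

/-- ★★ **THE WEIGHTED ABSTRACT LETTER.**  Let `T` have, at the fine bond `b′`, a column `(TZ)(x) = c(x)•Z(b′)` of mass `Σ_x |c(x)| ≤ K` whose support only meets bonds `b`
with `ω(b′) ≤ Θ·ω(b)` (weight comparison along the column), and let `Rᵀ` be skew-valued with the transpose identity on skew tests.  Then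
`ω(b′)·‖(RᵀV)(b′)‖ ≤ 2·d·K·Θ·s` whenever `ω(b)·‖V(b)‖ ≤ s` for all `b` (`ω(b′) > 0`). [cite: Balaban1985Variational, (98) p.292, (127)-(128) p.297] -/
theorem weighted_norm_transpose_apply_le
    (T : (PBond P 0 → Matrix (Fin N) (Fin N) ℂ) → Site P 0 → Matrix (Fin N) (Fin N) ℂ)
    (Rt : (PBond P 0 → Matrix (Fin N) (Fin N) ℂ) → PBond P 0 → Matrix (Fin N) (Fin N) ℂ)
    (hRt : ∀ W b, (Rt W b)ᴴ = -Rt W b)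
    (htr : ∀ δ W : PBond P 0 → Matrix (Fin N) (Fin N) ℂ, (∀ b, (δ b)ᴴ = -δ b) →
      ∑ b, ((δ b)ᴴ * Rt W b).trace.re = ∑ b, ((T δ b.tgt - T δ b.src)ᴴ * W b).trace.re)
    {K Θ : ℝ} (hK : 0 ≤ K) (hΘ : 0 ≤ Θ) (ω : PBond P 0 → ℝ) (b' : PBond P 0) (hωb' : 0 < ω b')
    (hcol : ∀ (Z : PBond P 0 → Matrix (Fin N) (Fin N) ℂ), (∀ b, b ≠ b' → Z b = 0) →
      ∃ c : Site P 0 → ℝ, (∀ x, T Z x = c x • Z b') ∧ ∑ x, |c x| ≤ K ∧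
        ∀ x, c x ≠ 0 → ∀ b : PBond P 0, (b.src = x ∨ b.tgt = x) → ω b' ≤ Θ * ω b)
    (V : PBond P 0 → Matrix (Fin N) (Fin N) ℂ) {s : ℝ} (hs : 0 ≤ s) (hV : ∀ b, ω b * ‖V b‖ ≤ s) :
    ω b' * ‖Rt V b'‖ ≤ 2 * P.d * K * Θ * s := by
  classical
  -- it suffices to bound the operator norm by `C = 2dKΘs ∕ ω(b′)`
  suffices h : ‖Rt V b'‖ ≤ 2 * P.d * K * Θ * s / ω b' by
    have := mul_le_mul_of_nonneg_left h hωb'.le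
    rwa [mul_div_cancel₀ _ hωb'.ne'] at this
  have hC : 0 ≤ 2 * P.d * K * Θ * s / ω b' := by positivity
  refine l2_opNorm_le_of_rankTwoSkew_tests (hRt V b') hC fun u v => ?_
  set E := Matrix.vecMulVec (ofLp u) (star (ofLp v)) - Matrix.vecMulVec (ofLp v) (star (ofLp u)) with hE
  have hEskew : Eᴴ = -E := conjTranspose_rankTwoSkew u v
  let δ : PBond P 0 → Matrix (Fin N) (Fin N) ℂ := fun b => if b = b' then E else 0
  have hδb' : δ b' = E := if_pos rfl
  have hδ0 : ∀ b, b ≠ b' → δ b = 0 := fun b hb => if_neg hb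
  have hδskew : ∀ b, (δ b)ᴴ = -δ b := fun b => by
    by_cases hb : b = b'
    · simp only [δ, if_pos hb, hEskew]
    · simp only [δ, if_neg hb, Matrix.conjTranspose_zero, neg_zero]
  have hL : ∑ b, ((δ b)ᴴ * Rt V b).trace.re = (Eᴴ * Rt V b').trace.re := by
    rw [Finset.sum_eq_single b' (fun b _ hb => by rw [hδ0 b hb, Matrix.conjTranspose_zero, Matrix.zero_mul, Matrix.trace_zero, Complex.zero_re])
      (fun h => absurd (Finset.mem_univ _) h), hδb']
  obtain ⟨c, hc, hcK, hcω⟩ := hcol δ hδ0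
  have hR : ∑ b, ((T δ b.tgt - T δ b.src)ᴴ * V b).trace.re = ∑ b, (c b.tgt - c b.src) * (Eᴴ * V b).trace.re := by
    refine Finset.sum_congr rfl fun b _ => ?_
    rw [hc, hc, hδb', ← sub_smul, Matrix.conjTranspose_smul, star_trivial, Matrix.smul_mul, Matrix.trace_smul, Complex.smul_re, smul_eq_mul]
  have hmain := htr δ V hδskew
  rw [hL, hR] at hmain
  rw [hmain]
  -- bond by bond: either both coefficients vanish, or the weight at `b` dominates `ω(b′)∕Θ`
  have huv : 0 ≤ ‖u‖ * ‖v‖ := by positivity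
  have hterm : ∀ b : PBond P 0,
      (c b.tgt - c b.src) * (Eᴴ * V b).trace.re ≤ (|c b.tgt| + |c b.src|) * (2 * (Θ * s / ω b') * ‖u‖ * ‖v‖) := fun b => by
    by_cases h0 : c b.tgt = 0 ∧ c b.src = 0
    · rw [h0.1, h0.2, sub_zero, zero_mul, abs_zero, add_zero, zero_mul]
    · -- some end-point of `b` carries a nonzero coefficient: `ω(b′) ≤ Θ·ω(b)`
      have hωb : ω b' ≤ Θ * ω b := by
        rcases not_and_or.mp h0 with h | h
        · exact hcω b.tgt h b (Or.inr rfl)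
        · exact hcω b.src h b (Or.inl rfl)
      have hωbpos : 0 < ω b := by
        by_contra hle
        have : Θ * ω b ≤ 0 := mul_nonpos_of_nonneg_of_nonpos hΘ (not_lt.mp hle)
        linarith
      have hVb : ‖V b‖ ≤ Θ * s / ω b' := by
        rw [le_div_iff₀ hωb']
        calc ‖V b‖ * ω b' ≤ ‖V b‖ * (Θ * ω b) := mul_le_mul_of_nonneg_left hωb (norm_nonneg _)
          _ = Θ * (ω b * ‖V b‖) := by ring
          _ ≤ Θ * s := mul_le_mul_of_nonneg_left (hV b) hΘ
      have h1 : |(Eᴴ * V b).trace.re| ≤ 2 * ‖V b‖ * ‖u‖ * ‖v‖ := abs_re_trace_rankTwoSkew_le u v (V b)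
      have h2 : 2 * ‖V b‖ * ‖u‖ * ‖v‖ ≤ 2 * (Θ * s / ω b') * ‖u‖ * ‖v‖ := by
        have := mul_le_mul_of_nonneg_right hVb huv
        nlinarith
      calc (c b.tgt - c b.src) * (Eᴴ * V b).trace.re ≤ |(c b.tgt - c b.src) * (Eᴴ * V b).trace.re| := le_abs_self _
        _ = |c b.tgt - c b.src| * |(Eᴴ * V b).trace.re| := abs_mul _ _
        _ ≤ (|c b.tgt| + |c b.src|) * (2 * (Θ * s / ω b') * ‖u‖ * ‖v‖) :=
            mul_le_mul (abs_sub _ _) (h1.trans h2) (abs_nonneg _) (by positivity)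
  have hd0 : (0 : ℝ) ≤ 2 * P.d := by positivity
  have hq : 0 ≤ 2 * (Θ * s / ω b') * ‖u‖ * ‖v‖ := by positivity
  calc ∑ b, (c b.tgt - c b.src) * (Eᴴ * V b).trace.re
      ≤ ∑ b : PBond P 0, (|c b.tgt| + |c b.src|) * (2 * (Θ * s / ω b') * ‖u‖ * ‖v‖) := Finset.sum_le_sum fun b _ => hterm b
    _ = (2 * P.d * ∑ x, |c x|) * (2 * (Θ * s / ω b') * ‖u‖ * ‖v‖) := by rw [← Finset.sum_mul, sum_bond_ends_eq]
    _ ≤ (2 * P.d * K) * (2 * (Θ * s / ω b') * ‖u‖ * ‖v‖) := mul_le_mul_of_nonneg_right (mul_le_mul_of_nonneg_left hcK hd0) hq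
    _ = 2 * (2 * P.d * K * Θ * s / ω b') * ‖u‖ * ‖v‖ := by ring

end Abstract

/-! ## §2  The corrected current with BOTH letters (𝔰𝔲(N)-valued tests) -/

section Main

variable [NeZero N] (D : Domains P)
  (hcollar : ∀ (i : ℕ) (e : PBond P (i + 1)), D.LamBond (i + 1) e → ∀ z : Site P i, (blockOf z = e.src ∨ blockOf z = e.tgt) → z ∈ D.Om i)

include hcollar in
/-- ★★★ **THE CORRECTED-CURRENT JUNCTION WITH THE UNWEIGHTED AND THE WEIGHTED k-UNIFORM SUP LETTERS** (𝔰𝔲(N)-valued tests; `d ≥ 2`): the gauge map `T` (p617458) and the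
skew Frobenius transpose `Rᵀ` of `∂∘T` with — p618723's conjuncts verbatim (`T` 𝔰𝔲-preserving, `T`'s letter, `Rᵀ` skew, transpose identity, junction hK+hDK+h127rec ⇒ h128) —
the unweighted letter `‖(RᵀV)(b)‖ ≤ 12·d·(d+2)L·s`, AND THE WEIGHTED LETTER in the (98)∕(152) currency: for the level weights `w_m(b) = (L^{levOf(b₋)}·(L⁻¹)^{k′})^m`
(`levOf` = territory over the family's regions, any `m`, any `k′`), `w_m(b′)·‖(RᵀV)(b′)‖ ≤ 12·d·(d+2)L·L^m·s` whenever `w_m(b)·‖V(b)‖ ≤ s` for all `b`.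
[cite: Balaban1985Variational, (98) p.292, (127)-(128) p.297, (152) p.301, (44)-(47) p.285; Balaban1984PropagatorsII, (2.1)-(2.4) p.224, (2.19)-(2.20) p.226; Balaban1985Averaging, (62) p.28] -/
theorem exists_correctedCurrent_letters_lieSU (hd : 2 ≤ P.d) :
    ∃ (T : (PBond P 0 → Matrix (Fin N) (Fin N) ℂ) →ₗ[ℂ] (Site P 0 → Matrix (Fin N) (Fin N) ℂ))
      (Rt : (PBond P 0 → Matrix (Fin N) (Fin N) ℂ) →ₗ[ℝ] (PBond P 0 → Matrix (Fin N) (Fin N) ℂ)),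
      (∀ Z : PBond P 0 → Matrix (Fin N) (Fin N) ℂ, (∀ b, Z b ∈ lieSU (Fin N)) → ∀ x, T Z x ∈ lieSU (Fin N)) ∧
      (∀ (Z : PBond P 0 → Matrix (Fin N) (Fin N) ℂ) (s : ℝ), 0 ≤ s → (∀ b, ‖Z b‖ ≤ s) →
        ∀ x, ‖T Z x‖ ≤ ((P.d + 2 : ℕ) : ℝ) * (P.L : ℝ) ^ (D.k + 1) * s) ∧
      (∀ W b, (Rt W b)ᴴ = -(Rt W b)) ∧
      (∀ δ W : PBond P 0 → Matrix (Fin N) (Fin N) ℂ, (∀ b, (δ b)ᴴ = -δ b) →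
        ∑ b, ((δ b)ᴴ * Rt W b).trace.re = ∑ b, ((T δ b.tgt - T δ b.src)ᴴ * W b).trace.re) ∧
      (∀ (W : PBond P 0 → Matrix (Fin N) (Fin N) ℂ) (s : ℝ), 0 ≤ s → (∀ b, ‖W b‖ ≤ s) →
        ∀ b, ‖Rt W b‖ ≤ 12 * P.d * (((P.d + 2) * P.L : ℕ) : ℝ) * s) ∧
      (∀ (m k' : ℕ) (W : PBond P 0 → Matrix (Fin N) (Fin N) ℂ) (s : ℝ), 0 ≤ s →
        (∀ b : PBond P 0, ((P.L : ℝ) ^ levOf (fun i => {y : Site P 0 | D.InOm i y}) D.k b.src * ((P.L : ℝ)⁻¹) ^ k') ^ m * ‖W b‖ ≤ s) →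
        ∀ b : PBond P 0, ((P.L : ℝ) ^ levOf (fun i => {y : Site P 0 | D.InOm i y}) D.k b.src * ((P.L : ℝ)⁻¹) ^ k') ^ m * ‖Rt W b‖ ≤
          12 * P.d * (((P.d + 2) * P.L : ℕ) : ℝ) * (P.L : ℝ) ^ m * s) ∧
      ∀ {instDE : DecidableEq (PBond P 0)} {QV : (PBond P 0 → Matrix (Fin N) (Fin N) ℂ) →ₗ[ℂ] (BondIdx D → Matrix (Fin N) (Fin N) ℂ)},
        (∀ (A : PBond P 0 → Matrix (Fin N) (Fin N) ℂ) (t : BondIdx D),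
          QV A t = ∑ j, ((WithLp.ofLp (QE D (WithLp.toLp 2 (Pi.single j 1))) t : ℝ) : ℂ) • A j) →
        ∀ (DVA Kf Wf : PBond P 0 → Matrix (Fin N) (Fin N) ℂ),
          (∀ μ : Site P 0 → lieSU (Fin N),
            ∑ b, (((μ b.tgt : Matrix (Fin N) (Fin N) ℂ) - (μ b.src : Matrix (Fin N) (Fin N) ℂ))ᴴ * Kf b).trace.re = 0) →
          (∀ δ : PBond P 0 → lieSU (Fin N), QV (fun b => (δ b : Matrix (Fin N) (Fin N) ℂ)) = 0 →
            ∑ b, (((δ b : Matrix (Fin N) (Fin N) ℂ))ᴴ * DVA b).trace.re = ∑ b, (((δ b : Matrix (Fin N) (Fin N) ℂ))ᴴ * Kf b).trace.re) →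
          (∀ δ : PBond P 0 → lieSU (Fin N),
            (∀ (j : ℕ) (c : PBond P j), D.LamBond j c →
              dIterL j (1 : PBond P 0 → Matrix (Fin N) (Fin N) ℂ) (fun b => (δ b : Matrix (Fin N) (Fin N) ℂ)) c = 0) →
            ∑ b, (((δ b : Matrix (Fin N) (Fin N) ℂ))ᴴ * (Kf b + Wf b)).trace.re = 0) →
          ∀ δ : PBond P 0 → lieSU (Fin N), QV (fun b => (δ b : Matrix (Fin N) (Fin N) ℂ)) = 0 →
            ∑ b, (((δ b : Matrix (Fin N) (Fin N) ℂ))ᴴ * (DVA b + (Wf b + Rt Wf b))).trace.re = 0 := by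
  classical
  obtain ⟨T, hTskew, hTsu, -, -, hTdich, hTletter, hTker⟩ := exists_linear_gauge_dIterL_one_eq_zero_of_bondAvgIter_eq_zero (N := N) D hcollar
    (fun j b => D.LamBond j b) (fun j b hb => lamSite_or_of_lamBond D hb) (fun j c hs ht => ⟨Or.inl hs.1, hs.2, ht.2⟩)
  -- the column of `T` with its support (`…ColumnTerritory` §1)
  have hcolS := fun b' Z hZ =>
    exists_column_support_of_dichotomy D hcollar (I := fun j b => D.LamBond j b) (fun j b hb => lamSite_or_of_lamBond D hb) hd T hTdich b' Z hZ
  have hcol : ∀ (b' : PBond P 0) (Z : PBond P 0 → Matrix (Fin N) (Fin N) ℂ), (∀ b, b ≠ b' → Z b = 0) →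
      ∃ c : Site P 0 → ℝ, (∀ x, T Z x = c x • Z b') ∧ ∑ x, |c x| ≤ 6 * (((P.d + 2) * P.L : ℕ) : ℝ) := fun b' Z hZ => by
    obtain ⟨c, hc, hcK, -⟩ := hcolS b' Z hZ
    exact ⟨c, hc, hcK⟩
  let S : (PBond P 0 → Matrix (Fin N) (Fin N) ℂ) →ₗ[ℝ] (PBond P 0 → Matrix (Fin N) (Fin N) ℂ) :=
    { toFun := fun Z b => T Z b.tgt - T Z b.src
      map_add' := fun Z Z' => by funext b; simp only [map_add, Pi.add_apply]; abel
      map_smul' := fun a Z => by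
        funext b
        simp only [RingHom.id_apply, Pi.smul_apply]
        rw [← Complex.coe_smul, map_smul, Pi.smul_apply, Pi.smul_apply, Complex.coe_smul, Complex.coe_smul, smul_sub] }
  have hS : ∀ Z b, S Z b = T Z b.tgt - T Z b.src := fun _ _ => rfl
  obtain ⟨St, hSt⟩ := exists_transpose_pairing S
  let skw : (PBond P 0 → Matrix (Fin N) (Fin N) ℂ) →ₗ[ℝ] (PBond P 0 → Matrix (Fin N) (Fin N) ℂ) :=
    { toFun := fun X b => (1 / 2 : ℝ) • (X b - (X b)ᴴ)
      map_add' := fun X X' => by funext b; simp only [Pi.add_apply, Matrix.conjTranspose_add]; rw [← smul_add]; congr 1; abel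
      map_smul' := fun a X => by
        funext b
        simp only [Pi.smul_apply, RingHom.id_apply, Matrix.conjTranspose_smul, star_trivial]
        rw [← smul_sub, smul_comm] }
  have hskw : ∀ X b, skw X b = (1 / 2 : ℝ) • (X b - (X b)ᴴ) := fun _ _ => rfl
  have hRtskew : ∀ W b, ((skw ∘ₗ St) W b)ᴴ = -((skw ∘ₗ St) W b) := fun W b => by
    rw [LinearMap.comp_apply, hskw, Matrix.conjTranspose_smul, star_trivial, Matrix.conjTranspose_sub, Matrix.conjTranspose_conjTranspose, ← smul_neg, neg_sub]
  have htr : ∀ δ W : PBond P 0 → Matrix (Fin N) (Fin N) ℂ, (∀ b, (δ b)ᴴ = -δ b) →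
      ∑ b, ((δ b)ᴴ * (skw ∘ₗ St) W b).trace.re = ∑ b, ((T δ b.tgt - T δ b.src)ᴴ * W b).trace.re := by
    intro δ W hδ
    have h2 : ∑ b, ((δ b)ᴴ * (skw ∘ₗ St) W b).trace.re = (1 / 2 : ℝ) * ∑ b, ((δ b)ᴴ * (St W b - (St W b)ᴴ)).trace.re := by
      rw [← pairing_smul_right]; rfl
    rw [h2, pairing_sub_right, pairing_conjTranspose_right_of_skew hδ, hSt]
    simp only [hS]
    ring
  refine ⟨T, skw ∘ₗ St, hTsu, hTletter, hRtskew, htr, fun W s hs hW b => ?_, fun m k' W s hs hW b' => ?_, ?_⟩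
  · have h := norm_transpose_apply_le (⇑T) (⇑(skw ∘ₗ St)) hRtskew htr (by positivity) hcol W hs hW b
    calc ‖(skw ∘ₗ St) W b‖ ≤ 2 * P.d * (6 * (((P.d + 2) * P.L : ℕ) : ℝ)) * s := h
      _ = 12 * P.d * (((P.d + 2) * P.L : ℕ) : ℝ) * s := by ring
  · -- THE WEIGHTED LETTER: §1 with `ω = w_m`, `Θ = L^m`, `K = 6(d+2)L`; the weight comparison along the column from `…ColumnTerritory` §1 + §2
    set lev : Site P 0 → ℕ := levOf (fun i => {y : Site P 0 | D.InOm i y}) D.k with hlev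
    let ω : PBond P 0 → ℝ := fun b => ((P.L : ℝ) ^ lev b.src * ((P.L : ℝ)⁻¹) ^ k') ^ m
    have hL1 : (1 : ℝ) ≤ P.L := by exact_mod_cast P.L_pos
    have hL0 : (0 : ℝ) < P.L := by positivity
    have hωpos : ∀ b, 0 < ω b := fun b => by positivity
    -- `lev(x) ≤ lev(z) + 1` ⇒ `ω` at a bond from `x` is at most `L^m` times `ω` at a bond from `z`
    have hcmp : ∀ b₁ b₂ : PBond P 0, lev b₁.src ≤ lev b₂.src + 1 → ω b₁ ≤ (P.L : ℝ) ^ m * ω b₂ := fun b₁ b₂ h => by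
      show ((P.L : ℝ) ^ lev b₁.src * ((P.L : ℝ)⁻¹) ^ k') ^ m ≤ (P.L : ℝ) ^ m * ((P.L : ℝ) ^ lev b₂.src * ((P.L : ℝ)⁻¹) ^ k') ^ m
      rw [← mul_pow]
      refine pow_le_pow_left₀ (by positivity) ?_ m
      calc (P.L : ℝ) ^ lev b₁.src * ((P.L : ℝ)⁻¹) ^ k' ≤ (P.L : ℝ) ^ (lev b₂.src + 1) * ((P.L : ℝ)⁻¹) ^ k' :=
            mul_le_mul_of_nonneg_right (pow_le_pow_right₀ hL1 h) (by positivity)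
        _ = (P.L : ℝ) * ((P.L : ℝ) ^ lev b₂.src * ((P.L : ℝ)⁻¹) ^ k') := by rw [pow_succ]; ring
    have hcolω : ∀ (Z : PBond P 0 → Matrix (Fin N) (Fin N) ℂ), (∀ b, b ≠ b' → Z b = 0) →
        ∃ c : Site P 0 → ℝ, (∀ x, T Z x = c x • Z b') ∧ ∑ x, |c x| ≤ 6 * (((P.d + 2) * P.L : ℕ) : ℝ) ∧
          ∀ x, c x ≠ 0 → ∀ b : PBond P 0, (b.src = x ∨ b.tgt = x) → ω b' ≤ (P.L : ℝ) ^ m * ω b := by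
      intro Z hZ
      obtain ⟨c, hc, hcK, hct⟩ := hcolS b' Z hZ
      refine ⟨c, hc, hcK, fun x hx b hb => hcmp b' b ?_⟩
      -- the territory of `x` is that of `b′₋`; `b₋` is `x` or a lattice neighbour of `x`
      have hxlev : lev x = lev b'.src :=
        (FlatCubeLevels.levOf_inOm_eq_iff D x _).2 (hct x hx _ ((FlatCubeLevels.levOf_inOm_eq_iff D b'.src _).1 rfl))
      rw [← hxlev]
      rcases hb with h | h
      · rw [h]; exact Nat.le_succ _
      · exact levOf_le_succ_of_adjacent D hcollar (x := b.src) (z := x) (μ := b.dir) (Or.inl h.symm)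
    have h := weighted_norm_transpose_apply_le (⇑T) (⇑(skw ∘ₗ St)) hRtskew htr (K := 6 * (((P.d + 2) * P.L : ℕ) : ℝ)) (Θ := (P.L : ℝ) ^ m)
      (by positivity) (by positivity) ω b' (hωpos b') hcolω W hs hW
    calc ω b' * ‖(skw ∘ₗ St) W b'‖ ≤ 2 * P.d * (6 * (((P.d + 2) * P.L : ℕ) : ℝ)) * (P.L : ℝ) ^ m * s := h
      _ = 12 * P.d * (((P.d + 2) * P.L : ℕ) : ℝ) * (P.L : ℝ) ^ m * s := by ring
  · intro instDE QV hQV DVA Kf Wf hK hDK h127 δ hQ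
    have hδ' : ∀ b, star ((δ b : Matrix (Fin N) (Fin N) ℂ)) = -(δ b : Matrix (Fin N) (Fin N) ℂ) := fun b => (mem_lieSU_iff.mp (δ b).2).1
    have hδ : ∀ b, ((δ b : Matrix (Fin N) (Fin N) ℂ))ᴴ = -(δ b : Matrix (Fin N) (Fin N) ℂ) := fun b => by
      rw [← Matrix.star_eq_conjTranspose]; exact hδ' b
    have h0' := (K0Stub1FlatAveragingDictionary.QV_eq_zero_iff D hQV (fun b => (δ b : Matrix (Fin N) (Fin N) ℂ))).1 hQ
    have h0 : ∀ (j : ℕ) (c : PBond P j), D.LamBond j c → bondAvgIter j (fun b => (δ b : Matrix (Fin N) (Fin N) ℂ)) c = 0 := fun j c hc =>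
      h0' ⟨⟨⟨j, Nat.lt_succ_of_le (D.le_of_lamBond hc)⟩, c⟩, hc⟩
    have hν : ∀ x, T (fun b => (δ b : Matrix (Fin N) (Fin N) ℂ)) x ∈ lieSU (Fin N) := hTsu _ fun b => (δ b).2
    let δ' : PBond P 0 → lieSU (Fin N) := fun b =>
      ⟨(δ b : Matrix (Fin N) (Fin N) ℂ) + (T (fun b => (δ b : Matrix (Fin N) (Fin N) ℂ)) b.tgt - T (fun b => (δ b : Matrix (Fin N) (Fin N) ℂ)) b.src),
        Submodule.add_mem _ (δ b).2 (Submodule.sub_mem _ (hν _) (hν _))⟩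
    have hδ'coe : (fun b => (δ' b : Matrix (Fin N) (Fin N) ℂ)) =
        fun b => (δ b : Matrix (Fin N) (Fin N) ℂ) + (T (fun b => (δ b : Matrix (Fin N) (Fin N) ℂ)) b.tgt - T (fun b => (δ b : Matrix (Fin N) (Fin N) ℂ)) b.src) := rfl
    have h1 := h127 δ' (by rw [hδ'coe]; exact hTker _ hδ' h0)
    have hδ'b : ∀ b, (δ' b : Matrix (Fin N) (Fin N) ℂ) =
        (δ b : Matrix (Fin N) (Fin N) ℂ) + (T (fun b => (δ b : Matrix (Fin N) (Fin N) ℂ)) b.tgt - T (fun b => (δ b : Matrix (Fin N) (Fin N) ℂ)) b.src) :=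
      fun b => rfl
    simp only [hδ'b] at h1
    rw [pairing_add_left, pairing_add_right, pairing_add_right] at h1
    have hKν := hK (fun x => ⟨T (fun b => (δ b : Matrix (Fin N) (Fin N) ℂ)) x, hν x⟩)
    rw [hKν, zero_add] at h1
    rw [pairing_add_right, pairing_add_right, hDK δ hQ, htr _ Wf hδ]
    linarith

end Main

end Summit.QuantumFields.YangMills.Theorems.K0Stub1CorrectedCurrentWeightedLetter

end
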